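import Literature.NumberTheory.Sieve.Maynard2016Lemma93CFree
import HarnessLib

/-!
# Maynard 2016, proof of Lemma 9.3 — the `c`-free Euler product regrouped (display (9.28))

Sources: J. Maynard, *Dense clusters of primes in subsets*, Compositio Math. 152 (2016) 1517–1554 =
arXiv:1405.2593 [Maynard2016DenseClusters], proof of Lemma 9.3, p. 24 (display (9.28)); K. Ford, B. Green,
S. Konyagin, J. Maynard, T. Tao, *Long gaps between primes*, JAMS 31 (2018) [FordGreenKonyaginMaynardTao2018],
§7 (7.8), Thm 6 (7.13).

The `c`-free product `P' = ∏_{p ≤ ⌊R⌋} Λ_p(∏ r)` of `FGKMT2018.eulerProd_update_div_phiOmega_eq` is regrouped by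
the census `FGKMT2018.eulerFactorM_sPrime` into the two classes of primes that contribute:
`P' = ∏_{p ≤ ⌊R⌋, good} X_p · ∏_{p ≤ ⌊R⌋, p ∈ 𝓜*} p/(p − 1)` (`eulerProd_eq_prod_good_mul_prod_mstar`), where
`good(p) :⇔ p ∤ WB, p ∤ ∏r, p ∤ a_m, m ∈ admIdx(p)` (factor `X_p = p/(p−1) − 1/(p−ω(p))`, the factor of
`MaynardDense.emEuler`) and `𝓜* :⇔ p ∤ WB, p ∤ ∏r, p ∤ a_m, m ∉ admIdx(p)` (Maynard's primes `p ∣ W_m`,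
`p ∤ W B r a_m`; factor `X_p + 1/(p − ω) = p/(p−1)`, `emFactor_add_inv_eq`); all other primes give `1`.
With `M₁ = ∏_{𝓜*} p` this is `P' = (M₁/φ(M₁))·emEuler (a_m·WB·∏r·M₁) ω (⌊R⌋+1)` — display (9.28) in finite form.

## References
* J. Maynard, *Dense clusters of primes in subsets*, Compositio Math. 152 (2016), proof of Lemma 9.3
  p. 24, (9.28) [Maynard2016DenseClusters].
* K. Ford, B. Green, S. Konyagin, J. Maynard, T. Tao, *Long gaps between primes*, JAMS 31 (2018), §7 (7.8),
  Thm 6 (7.13) [FordGreenKonyaginMaynardTao2018].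
-/

noncomputable section

open Finset
open scoped Nat

namespace Literature.NumberTheory.Sieve

namespace FGKMT2018

variable {k : ℕ}

/-- `X_p + 1/(p − ω) = p/(p − 1)`. [cite: Maynard2016DenseClusters, proof of Lemma 9.3 p. 24, (9.28)] -/
theorem emFactor_add_inv_eq (p ω : ℝ) :
    p / (p - 1) - 1 / (p - ω) + 1 / (p - ω) = p / (p - 1) := by
  ring

/-- **`P'` regrouped** (display (9.28), finite form): for admissible `𝓛`,
`∏_{p ∣ N} Λ_p(M) = ∏_{p ∣ N, good} X_p · ∏_{p ∣ N, 𝓜*} p/(p−1)` with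
`good(p) :⇔ (p, WB) = 1 ∧ p ∤ M ∧ p ∤ a_m ∧ m ∈ admIdx(p)` and `𝓜*(p) :⇔ (p, WB) = 1 ∧ p ∤ M ∧ p ∤ a_m ∧ m ∉ admIdx(p)`.
[cite: Maynard2016DenseClusters, proof of Lemma 9.3 p. 24, (9.27)–(9.28)] -/
theorem eulerProd_eq_prod_good_mul_prod_mstar {L : Fin k → ℤ × ℤ} (hadm : FormsAdmissible L) (B : ℕ)
    (m : Fin k) (M : ℕ) (S : Finset ℕ) (hS : ∀ p ∈ S, p.Prime) :
    ∏ p ∈ S, eulerFactorM L B m M (fun p j => sPrimeM L m j p / ((p : ℝ) - omegaL L p)) p =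
      (∏ p ∈ S.filter (fun p => p.Coprime (wCut k B * B) ∧ ¬ p ∣ M ∧ ¬ p ∣ (L m).1.natAbs ∧
          m ∈ admIdx L p), ((p : ℝ) / ((p : ℝ) - 1) - 1 / ((p : ℝ) - omegaL L p))) *
        ∏ p ∈ S.filter (fun p => p.Coprime (wCut k B * B) ∧ ¬ p ∣ M ∧ ¬ p ∣ (L m).1.natAbs ∧
          m ∉ admIdx L p), (p : ℝ) / ((p : ℝ) - 1) := by
  classical
  rw [Finset.prod_filter, Finset.prod_filter, ← Finset.prod_mul_distrib]
  refine Finset.prod_congr rfl fun p hp => ?_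
  have hpp : p.Prime := hS p hp
  have hωlt : omegaL L p < p := ((formsAdmissible_iff_omegaL L).1 hadm).2 p hpp
  have hpω : ((p : ℝ) - omegaL L p) ≠ 0 := by
    have : (omegaL L p : ℝ) < p := by exact_mod_cast hωlt
    linarith
  have hp1 : ((p : ℝ) - 1) ≠ 0 := by
    have : (1 : ℝ) < p := by exact_mod_cast hpp.one_lt
    linarith
  rw [eulerFactorM_sPrime hadm B m M hpp]
  by_cases hc : p.Coprime (wCut k B * B) ∧ ¬ p ∣ M
  · rw [if_pos hc]
    by_cases hpa : p ∣ (L m).1.natAbs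
    · rw [if_pos hpa, if_neg fun h => h.2.2.1 hpa, if_neg fun h => h.2.2.1 hpa, mul_one]
    · rw [if_neg hpa]
      by_cases hm : m ∈ admIdx L p
      · rw [if_pos hm, if_pos ⟨hc.1, hc.2, hpa, hm⟩, if_neg fun h => h.2.2.2 hm, zero_div, add_zero,
          mul_one, one_sub_div_eq_emFactor hp1 hpω]
      · rw [if_neg hm, if_neg fun h => hm h.2.2.2, if_pos ⟨hc.1, hc.2, hpa, hm⟩, one_mul,
          one_sub_div_eq_emFactor hp1 hpω, emFactor_add_inv_eq]
  · rw [if_neg hc, if_neg fun h => hc ⟨h.1, h.2.1⟩, if_neg fun h => hc ⟨h.1, h.2.1⟩, mul_one]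

/-- The primes of `⌊R⌋#` are the primes `≤ ⌊R⌋`, i.e. `Nat.primesBelow (⌊R⌋₊ + 1)` (the index set of
`MaynardDense.emEuler … (⌊R⌋₊ + 1)`). [cite: Maynard2016DenseClusters, proof of Lemma 9.3 p. 24, (9.28)] -/
theorem primeFactors_primorial_eq_primesBelow (n : ℕ) :
    (primorial n).primeFactors = Nat.primesBelow (n + 1) := by
  ext p
  rw [Nat.mem_primeFactors, Nat.mem_primesBelow, Nat.lt_succ_iff]
  constructor
  · rintro ⟨hp, hdvd, -⟩
    exact ⟨hp.dvd_primorial_iff.1 hdvd, hp⟩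
  · rintro ⟨hle, hp⟩
    exact ⟨hp, hp.dvd_primorial_iff.2 hle, primorial_ne_zero n⟩

/-- `∏_{p ∈ S} p/(p−1) = M₁/φ(M₁)` for a set `S` of primes, `M₁ = ∏_{S} p`.
[cite: Maynard2016DenseClusters, proof of Lemma 9.3 p. 24, (9.28) («W_m/φ(W_m)»)] -/
theorem prod_div_sub_one_eq (S : Finset ℕ) (hS : ∀ p ∈ S, p.Prime) :
    ∏ p ∈ S, (p : ℝ) / ((p : ℝ) - 1) = ((∏ p ∈ S, p : ℕ) : ℝ) / (Nat.totient (∏ p ∈ S, p) : ℝ) := by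
  classical
  induction S using Finset.induction_on with
  | empty => simp
  | insert a s ha ih =>
    have hap : a.Prime := hS a (Finset.mem_insert_self a s)
    have hs' : ∀ p ∈ s, p.Prime := fun p hp => hS p (Finset.mem_insert_of_mem hp)
    have hcop : a.Coprime (∏ p ∈ s, p) := by
      refine Nat.Coprime.prod_right fun p hp => (Nat.coprime_primes hap (hs' p hp)).2 ?_
      rintro rfl; exact ha hp
    rw [Finset.prod_insert ha, Finset.prod_insert ha, ih hs', Nat.totient_mul hcop,
      Nat.totient_prime hap, Nat.cast_mul, Nat.cast_mul, Nat.cast_sub hap.one_le, Nat.cast_one,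
      mul_div_mul_comm]

end FGKMT2018

end Literature.NumberTheory.Sieve
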